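import Literature.NumberTheory.GaloisCohomology.LocalInvariantMapEvaluation
import Literature.NumberTheory.GaloisCohomology.ArchimedeanInvariantMap
import Literature.AnabelianGeometry.AbsoluteAnabelian.GaloisCyclotomeH2Levels
import Mathlib.NumberTheory.NumberField.InfinitePlace.TotallyRealComplex
import HarnessLib

/-!
# The reciprocity law for the canonical invariant maps: reduction to prime-power levels

Let `K` be a number field and `(inv_v)_v = LocalInvariants.canonical K n` the pinned family of local
invariant maps of the tree (`ArchimedeanInvariantMap.lean`: THE residue maps
`localInvariantMap K n v` at the finite places, `archimedeanInvariantMap` at the infinite ones).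
The named fact `poitouTate_sum_localTatePairing_eq_zero K` is reduced in the tree to the
reciprocity law of the Brauer group for this family,
`∀ n, (LocalInvariants.canonical K n).SumInvLocalizationEqZero`
(`poitouTate_sum_localTatePairing_eq_zero_of_canonical`), i.e. `∑_v inv_v (loc_v c) = 0` for
`c ∈ H²(Γ_K, μₙ) = Br(K)[n]` (Tate, Cassels–Fröhlich VII §11; Harari Thm. 14.11).  Since
`Br(K)[n] = ⊕_p Br(K)[p^{v_p(n)}]` and the invariant maps of the various levels are compatible
inside `ℚ/ℤ`, it suffices to know the law at PRIME-POWER levels — which is where the cyclotomic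
killing lemma and the cyclic reciprocity law of the (F1) campaign operate.  This file PROVES that
reduction for totally complex `K` (theorems only; no definition, no named fact):

* `resMu_cohomologyMap_muPowHom` — restriction along an extension commutes with the power maps
  `H²(μ_N ↠ μₙ)` (companion of the tree's `Prop121vii.resMu_cohomologyMap_muInclHom`);
* `localInvariantMap_localization_cohomologyMap_muInclHom` — **level change along `μₙ ⊆ μ_N`**:
  `inv_v^{(N)} (loc_v (H²(⊆) x)) = (N/n) · inv_v^{(n)} (loc_v x)` (from transfer-2's dictionary
  `localInvariantMap_localization` and the anabelian colimit clause
  `Prop121vii.invariantMap_muInclHom_compat` for `K_v`);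
* `localInvariantMap_localization_cohomologyMap_muPowHom` — **level change along `μ_N ↠ μₙ`**:
  `inv_v^{(n)} (loc_v (H²(↠) x)) = inv_v^{(N)} (loc_v x) mod n` (`invLevel_muPowHom` for `K_v`);
* `sumInvLocalizationEqZero_canonical_of_coprime` — the law at level `ab` from the levels `a`, `b`
  coprime (Bezout `1 = ea + fb`, `a·c = H²(μ_b ⊆ μ_{ab}) (H²(μ_{ab} ↠ μ_b) c)` by
  `cohomologyMap_muInclHom_muPowHom`, and the two level changes);
* `sumInvLocalizationEqZero_canonical_of_primePow` — **the reduction**: for totally complex `K`,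
  the law at all prime-power levels implies the law at every level `n ≥ 1`.

The totally complex hypothesis only serves to dispose of the infinite places (every term vanishes
there, `LocalInvariants.canonical_inl_eq_zero_of_isComplex`); it is the case of the (F1) milestone
(`stub_textbookDualityImQuad` of the bsd-cn100 routes: imaginary quadratic `K`).

## Design notes

* The embeddings `ℤ/m ↪ ℤ/n`, `k ↦ k·(n/m)`, are built inside the proof (`ZMod.lift`); statements
  use the tree's form `((k.val * (N/n) : ℕ) : ZMod N)` of `Prop121vii.invariantMap_muInclHom_compat`.
* Real places (general `K`) would need the analogous level compatibilities of
  `archimedeanInvariantMap` (its values lie in `{0, n/2}`); not needed for the milestone, not here.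
* No instance; `CompactSpace (absoluteGaloisGroup ·)` by `haveI` inside statements and proofs.

## References

* J. Tate, *Global class field theory*, in Cassels–Fröhlich (eds.), *Algebraic Number Theory*
  (1967), Ch. VII §11 (proof of the reciprocity law; reduction to cyclic cyclotomic layers of
  prime-power degree). [CasselsFrohlich1967]
* J.-P. Serre, *Corps locaux* (1968) / *Local Fields* (1979), XIII §3 (`Br(K_v) = ∪ₙ H²(μₙ)`,
  `inv` on the union). [SerreLocalFields1979]
* J.-P. Serre, *Galois Cohomology* (1997), I §2.4 (compatible pairs). [SerreGaloisCohomology1997]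
* D. Harari, *Galois Cohomology and Class Field Theory* (2020), Thm. 14.11. [Harari2020]

## Tree search

`lean search 'resMu_cohomologyMap_muPow|cohomologyMap_muInclHom|of_coprime|of_primePow'`: only the
anabelian `resMu_cohomologyMap_muInclHom`, `cohomologyMap_muInclHom_muPowHom`, `invLevel_muPowHom`,
`invariantMap_muInclHom_compat` (inputs).  Other inputs: `localInvariantMap_localization`
(`LocalInvariantMapEvaluation.lean`), `LocalInvariants.canonical`, `canonical_inr`,
`LocalInvariants.canonical_inl_eq_zero_of_isComplex` (`ArchimedeanInvariantMap.lean`), Mathlib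
`Nat.ordProj_mul_ordCompl_eq_self`, `Nat.coprime_ordCompl`, `Nat.isCoprime_iff_coprime`.
-/

noncomputable section

open CategoryTheory Function NumberField IsDedekindDomain Field
open scoped NumberField

universe u

namespace Literature.NumberTheory.GaloisCohomology

open _root_.ContinuousCohomology
open Literature.NumberTheory.GaloisRepresentations
open Literature.NumberTheory.GaloisRepresentations.DiscreteGaloisModule
open Literature.AnabelianGeometry.AbsoluteAnabelian
open Literature.AnabelianGeometry.AbsoluteAnabelian.Prop121vii

/-! ### §1. Restriction commutes with the power maps `μ_N ↠ μₙ` -/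

section ResPow

variable (F E : Type u) [Field F] [Field E] [Algebra F E]

/-- `Res_{E/F}` commutes with the power maps `H²(μ_N ↠ μₙ)` (`ζ ↦ ζ^d`, `n d = N`): functoriality of
the compatible-pair maps (the companion of the tree's `Prop121vii.resMu_cohomologyMap_muInclHom` for
the inclusions). [cite: SerreGaloisCohomology1997, I §2.4] -/
theorem resMu_cohomologyMap_muPowHom {n d N : ℕ} (h : n * d = N) (x : galoisCohomology (mu F N) 2) :
    haveI : CompactSpace (absoluteGaloisGroup F) := absoluteGaloisGroup_compactSpace F
    haveI : CompactSpace (absoluteGaloisGroup E) := absoluteGaloisGroup_compactSpace E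
    resMu F E n 2 (cohomologyMap (muPowHom F N n d h) 2 x) =
      cohomologyMap (muPowHom E N n d h) 2 (resMu F E N 2 x) := by
  haveI : CompactSpace (absoluteGaloisGroup F) := absoluteGaloisGroup_compactSpace F
  haveI : CompactSpace (absoluteGaloisGroup E) := absoluteGaloisGroup_compactSpace E
  obtain ⟨c, rfl⟩ := twoCocycleClass_surjective _ x
  rw [resMu_apply, resMu_apply, cohomologyMap_twoCocycleClass, map_twoCocycleClass,
    map_twoCocycleClass, cohomologyMap_twoCocycleClass]
  refine congrArg (twoCocycleClass _) (Subtype.ext (ContinuousMap.ext fun p => ?_))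
  obtain ⟨σ, τ⟩ := p
  rw [contTwoCocycles.pullback_apply, pullback₂_id_resIdHom_apply, pullback₂_id_resIdHom_apply,
    contTwoCocycles.pullback_apply, resCoeff_hom_apply, resCoeff_hom_apply, muPowHom_hom_apply,
    muPowHom_hom_apply]
  apply muVal_injective E n
  refine Units.ext ?_
  rw [muVal_muPow, coe_muVal_muRes, Units.val_pow_eq_pow_val, coe_muVal_muRes, muVal_muPow,
    Units.val_pow_eq_pow_val, map_pow]

end ResPow

/-! ### §2. The finite components of the canonical family along `μₙ ⊆ μ_N` and `μ_N ↠ μₙ` -/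

section Levels

variable {K : Type u} [Field K] [NumberField K] {n : ℕ} [NeZero n]

/-- **Level change for `inv_v` along `μₙ ⊆ μ_N`** (on localisations of global classes): for
`n ∣ N` and `x ∈ H²(Γ_K, μₙ(K̄))`, `inv_v^{(N)} (loc_v (H²(μₙ ⊆ μ_N) x)) = (N/n) · inv_v^{(n)} (loc_v x)`
read in `ℤ/N` — the invariant maps of the levels are compatible with `(1/n)ℤ/ℤ ⊆ (1/N)ℤ/ℤ ⊆ ℚ/ℤ`.
From `inv_v ∘ loc_v = inv_{K_v} ∘ Res` (transfer-2's `localInvariantMap_localization`), the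
commutation of `Res` with the inclusions (`Prop121vii.resMu_cohomologyMap_muInclHom`) and the level
compatibility of THE residue maps of `K_v` (`Prop121vii.invariantMap_muInclHom_compat`, the tree's
colimit clause).
Ref: Serre, *Corps locaux* (1968), XIII §3 (`inv : Br(K_v) = ∪ H²(μₙ) → ℚ/ℤ`); Milne, *Arithmetic
Duality Theorems* (2006), I §1. [cite: SerreLocalFields1979, XIII §3 Cor. 3] -/
theorem localInvariantMap_localization_cohomologyMap_muInclHom {N : ℕ} [NeZero N] (hnN : n ∣ N)
    (v : HeightOneSpectrum (𝓞 K)) (x : galoisCohomology (mu K n) 2) :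
    haveI : CompactSpace (absoluteGaloisGroup K) := absoluteGaloisGroup_compactSpace K
    localInvariantMap K N v (galoisCohomology.localization (mu K N) (Sum.inr v) 2
        (cohomologyMap (muInclHom K hnN) 2 x)) =
      (((localInvariantMap K n v (galoisCohomology.localization (mu K n) (Sum.inr v) 2 x)).val *
        (N / n) : ℕ) : ZMod N) := by
  haveI : CompactSpace (absoluteGaloisGroup K) := absoluteGaloisGroup_compactSpace K
  haveI : CharZero (v.adicCompletion K) := charZero_adicCompletion v
  haveI : CompactSpace (absoluteGaloisGroup (v.adicCompletion K)) :=
    absoluteGaloisGroup_compactSpace _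
  rw [localInvariantMap_localization, localInvariantMap_localization, resMu_cohomologyMap_muInclHom]
  exact invariantMap_muInclHom_compat (v.adicCompletion K) hnN _ _
    (isInvariantMap_invLevel _ n) (isInvariantMap_invLevel _ N) _

/-- **Level change for `inv_v` along `μ_N ↠ μₙ`** (on localisations of global classes): for
`n d = N` and `x ∈ H²(Γ_K, μ_N(K̄))`, `inv_v^{(n)} (loc_v (H²(μ_N ↠ μₙ) x))` is the reduction
`ℤ/N ↠ ℤ/n` of `inv_v^{(N)} (loc_v x)`.  From `localInvariantMap_localization`,
`resMu_cohomologyMap_muPowHom` and the tree's `invLevel_muPowHom` (the residue maps of `K_v`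
commute with the power maps).
Ref: Serre, *Corps locaux* (1968), XIII §3; [AbsTopIII] Cor. 1.10 (i) for the inverse system.
[cite: SerreLocalFields1979, XIII §3 Cor. 3] -/
theorem localInvariantMap_localization_cohomologyMap_muPowHom {N d : ℕ} [NeZero N] (h : n * d = N)
    (v : HeightOneSpectrum (𝓞 K)) (x : galoisCohomology (mu K N) 2) :
    haveI : CompactSpace (absoluteGaloisGroup K) := absoluteGaloisGroup_compactSpace K
    localInvariantMap K n v (galoisCohomology.localization (mu K n) (Sum.inr v) 2
        (cohomologyMap (muPowHom K N n d h) 2 x)) =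
      ZMod.castHom (Dvd.intro d h) (ZMod n)
        (localInvariantMap K N v (galoisCohomology.localization (mu K N) (Sum.inr v) 2 x)) := by
  haveI : CompactSpace (absoluteGaloisGroup K) := absoluteGaloisGroup_compactSpace K
  haveI : CharZero (v.adicCompletion K) := charZero_adicCompletion v
  haveI : CompactSpace (absoluteGaloisGroup (v.adicCompletion K)) :=
    absoluteGaloisGroup_compactSpace _
  rw [localInvariantMap_localization, localInvariantMap_localization, resMu_cohomologyMap_muPowHom]
  exact invLevel_muPowHom (v.adicCompletion K) h _

end Levels

/-! ### §3. Reduction of the reciprocity law `∑_v inv_v = 0` to prime-power levels -/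

section Reduction

variable {K : Type u} [Field K] [NumberField K]

/-- **The reciprocity law for the canonical family at level `a·b` from the levels `a`, `b`
(`a`, `b` coprime)**, for a totally complex number field `K`.  Write `1 = e a + f b`; for
`c ∈ H²(Γ_K, μ_{ab})`, `c = e·(a·c) + f·(b·c)` and `a·c = H²(μ_b ⊆ μ_{ab})(H²(μ_{ab} ↠ μ_b) c)`
(`cohomologyMap_muInclHom_muPowHom`); the invariants of the two pieces are the embedded invariants
of the levels `b`, `a` (`localInvariantMap_localization_cohomologyMap_muInclHom`), whose sums over
`S` vanish by hypothesis — the classes `H²(↠) c` have vanishing invariants outside `S` by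
`localInvariantMap_localization_cohomologyMap_muPowHom`; at the (complex) infinite places every
term vanishes (`LocalInvariants.canonical_inl_eq_zero_of_isComplex`).
Ref: Tate, in Cassels–Fröhlich (1967), VII §11 (reduction of the reciprocity law to cyclic layers
of prime-power degree); Serre, *Corps locaux* XIII §3. [cite: CasselsFrohlich1967, Ch. VII §11] -/
theorem sumInvLocalizationEqZero_canonical_of_coprime [IsTotallyComplex K] {a b n : ℕ} [NeZero a]
    [NeZero b] [NeZero n] (hn : a * b = n) (hab : a.Coprime b)
    (ha : (LocalInvariants.canonical K a).SumInvLocalizationEqZero)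
    (hb : (LocalInvariants.canonical K b).SumInvLocalizationEqZero) :
    (LocalInvariants.canonical K n).SumInvLocalizationEqZero := by
  haveI : CompactSpace (absoluteGaloisGroup K) := absoluteGaloisGroup_compactSpace K
  intro c S hS
  have hn' : b * a = n := by rw [mul_comm, hn]
  -- Bezout
  obtain ⟨e, f, hef⟩ := Nat.isCoprime_iff_coprime.2 hab
  -- the embeddings `ℤ/m ↪ ℤ/n`, `k ↦ k·(n/m)`, as additive maps
  have hΨ : ∀ {m d : ℕ} [NeZero m], m * d = n →
      ∃ Ψ : ZMod m →+ ZMod n, ∀ k : ZMod m, Ψ k = ((k.val * d : ℕ) : ZMod n) := by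
    intro m d _ hmd
    refine ⟨ZMod.lift m ⟨zmultiplesHom (ZMod n) (d : ZMod n), ?_⟩, fun k => ?_⟩
    · rw [zmultiplesHom_apply, natCast_zsmul, nsmul_eq_mul, ← Nat.cast_mul, hmd, ZMod.natCast_self]
    · have hk : ((k.val : ℤ) : ZMod m) = k := by rw [Int.cast_natCast, ZMod.natCast_zmod_val]
      conv_lhs => rw [← hk]
      rw [ZMod.lift_coe]
      change ((k.val : ℕ) : ℤ) • (d : ZMod n) = _
      rw [natCast_zsmul, nsmul_eq_mul, Nat.cast_mul]
  obtain ⟨Ψb, hΨb⟩ := hΨ hn'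
  obtain ⟨Ψa, hΨa⟩ := hΨ hn
  -- the two pieces `y_a = H²(μ_n ↠ μ_a) c`, `y_b = H²(μ_n ↠ μ_b) c`
  set ya : galoisCohomology (mu K a) 2 := cohomologyMap (muPowHom K n a b hn) 2 c with hya
  set yb : galoisCohomology (mu K b) 2 := cohomologyMap (muPowHom K n b a hn') 2 c with hyb
  have hbc : (b : ℤ) • c = cohomologyMap (muInclHom K (Dvd.intro b hn)) 2 ya := by
    rw [hya, natCast_zsmul]
    exact (cohomologyMap_muInclHom_muPowHom K hn c).symm
  have hac : (a : ℤ) • c = cohomologyMap (muInclHom K (Dvd.intro a hn')) 2 yb := by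
    rw [hyb, natCast_zsmul]
    exact (cohomologyMap_muInclHom_muPowHom K hn' c).symm
  have hNa : n / b = a := by rw [← hn', Nat.mul_div_cancel_left a (NeZero.pos b)]
  have hNb : n / a = b := by rw [← hn, Nat.mul_div_cancel_left b (NeZero.pos a)]
  -- the local terms, place by place
  have key : ∀ v : Place K,
      LocalInvariants.canonical K n v (galoisCohomology.localization (mu K n) v 2 c) =
        e • Ψb (LocalInvariants.canonical K b v
            (galoisCohomology.localization (mu K b) v 2 yb)) +
          f • Ψa (LocalInvariants.canonical K a v
            (galoisCohomology.localization (mu K a) v 2 ya)) := by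
    intro v
    rcases v with w | v
    · rw [LocalInvariants.canonical_inl_eq_zero_of_isComplex (IsTotallyComplex.isComplex w),
        LocalInvariants.canonical_inl_eq_zero_of_isComplex (IsTotallyComplex.isComplex w),
        LocalInvariants.canonical_inl_eq_zero_of_isComplex (IsTotallyComplex.isComplex w),
        map_zero, map_zero, smul_zero, smul_zero, add_zero]
    · -- the invariant at `v` as an additive function of the global class
      set Φ : galoisCohomology (mu K n) 2 →+ ZMod n :=
        (LocalInvariants.canonical K n (Sum.inr v)).comp
          (galoisCohomology.localization (mu K n) (Sum.inr v) 2) with hΦ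
      have hΦc : Φ c = e • Φ ((a : ℤ) • c) + f • Φ ((b : ℤ) • c) := by
        rw [map_zsmul, map_zsmul, smul_smul, smul_smul, ← add_smul, hef, one_smul]
      change Φ c = _
      rw [hΦc, hac, hbc, hΦ, AddMonoidHom.comp_apply, AddMonoidHom.comp_apply,
        LocalInvariants.canonical_inr, LocalInvariants.canonical_inr, LocalInvariants.canonical_inr,
        localInvariantMap_localization_cohomologyMap_muInclHom,
        localInvariantMap_localization_cohomologyMap_muInclHom, hΨb, hΨa, hNa, hNb]
  -- the pieces have vanishing invariants outside `S`
  have hSb : ∀ v ∉ S, LocalInvariants.canonical K b v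
      (galoisCohomology.localization (mu K b) v 2 yb) = 0 := by
    intro v hv
    rcases v with w | v
    · exact LocalInvariants.canonical_inl_eq_zero_of_isComplex (IsTotallyComplex.isComplex w) _
    · rw [LocalInvariants.canonical_inr, hyb, localInvariantMap_localization_cohomologyMap_muPowHom,
        ← LocalInvariants.canonical_inr, hS _ hv, map_zero]
  have hSa : ∀ v ∉ S, LocalInvariants.canonical K a v
      (galoisCohomology.localization (mu K a) v 2 ya) = 0 := by
    intro v hv
    rcases v with w | v
    · exact LocalInvariants.canonical_inl_eq_zero_of_isComplex (IsTotallyComplex.isComplex w) _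
    · rw [LocalInvariants.canonical_inr, hya, localInvariantMap_localization_cohomologyMap_muPowHom,
        ← LocalInvariants.canonical_inr, hS _ hv, map_zero]
  -- sum up
  rw [Finset.sum_congr rfl fun v _ => key v, Finset.sum_add_distrib, ← Finset.smul_sum,
    ← Finset.smul_sum, ← map_sum, ← map_sum, hb yb S hSb, ha ya S hSa, map_zero, map_zero,
    smul_zero, smul_zero, add_zero]

/-- **Reduction of the reciprocity law for THE invariant maps to prime-power levels.**  For a totally
complex number field `K`: if the canonical family of local invariant maps satisfies
`∑_v inv_v (loc_v c) = 0` on `H²(Γ_K, μ_q)` for every prime power `q`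
(`LocalInvariants.SumInvLocalizationEqZero`, the Albert–Brauer–Hasse–Noether relation on
`Br(K)[q]`), then it does so at every level `n ≥ 1` (`Br(K)[n] = ⊕_p Br(K)[p^{v_p(n)}]`; induction on
`n` splitting off one prime-power factor with `sumInvLocalizationEqZero_canonical_of_coprime`).
This is the reduction step of the (F1) campaign: the prime-power levels are where the cyclotomic
killing and the cyclic reciprocity law apply.
Ref: Tate, in Cassels–Fröhlich (1967), VII §11; Serre, *Corps locaux* XIII §3.
[cite: CasselsFrohlich1967, Ch. VII §11] -/
theorem sumInvLocalizationEqZero_canonical_of_primePow [IsTotallyComplex K]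
    (h : ∀ (q : ℕ) [NeZero q], IsPrimePow q → (LocalInvariants.canonical K q).SumInvLocalizationEqZero)
    (n : ℕ) [NeZero n] : (LocalInvariants.canonical K n).SumInvLocalizationEqZero := by
  -- strong induction on the level, generalising the `NeZero` instance
  have main : ∀ (m : ℕ) (_ : NeZero m), (LocalInvariants.canonical K m).SumInvLocalizationEqZero := by
    intro m
    induction m using Nat.strong_induction_on with
    | _ m ih =>
      intro _
      rcases Nat.lt_or_ge 1 m with hm1 | hm1
      swap
      · -- `m = 1`: `ℤ/1` is trivial
        have hm : m = 1 := le_antisymm hm1 (NeZero.pos m)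
        subst hm
        intro c S _
        exact Subsingleton.elim _ _
      -- split off the `p`-primary part of `m` for a prime `p ∣ m`
      obtain ⟨p, hp, hpm⟩ := Nat.exists_prime_and_dvd (ne_of_gt hm1)
      have hm0 : m ≠ 0 := NeZero.ne m
      have habm : ordProj[p] m * ordCompl[p] m = m := Nat.ordProj_mul_ordCompl_eq_self m p
      have hab : (ordProj[p] m).Coprime (ordCompl[p] m) := (Nat.coprime_ordCompl hp hm0).pow_left _
      have hk : 0 < m.factorization p := Nat.Prime.factorization_pos_of_dvd hp hm0 hpm
      haveI : NeZero (ordProj[p] m) := ⟨pow_ne_zero _ hp.ne_zero⟩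
      have hb0 : 0 < ordCompl[p] m := Nat.ordCompl_pos p hm0
      haveI hb : NeZero (ordCompl[p] m) := ⟨hb0.ne'⟩
      have ha1 : 1 < ordProj[p] m := Nat.one_lt_pow hk.ne' hp.one_lt
      have hbm : ordCompl[p] m < m := by
        calc ordCompl[p] m = 1 * ordCompl[p] m := (one_mul _).symm
          _ < ordProj[p] m * ordCompl[p] m := Nat.mul_lt_mul_of_pos_right ha1 hb0
          _ = m := habm
      exact sumInvLocalizationEqZero_canonical_of_coprime habm hab
        (h (ordProj[p] m) ⟨p, m.factorization p, hp.prime, hk, rfl⟩) (ih _ hbm hb)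
  exact main n inferInstance

end Reduction

end Literature.NumberTheory.GaloisCohomology

end
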